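import Literature.InformationTheory.QuantumCodes.ConnectivityDimensionBound
import HarnessLib

/-!
# Separation profile bounds the distance: the degree-oblivious Bravyi–Terhal bound (Baspin–Guruswami–Krishna–Li) — PROVED

N. Baspin, V. Guruswami, A. Krishna, R. Li, *Improved rate-distance trade-offs for quantum codes with restricted
connectivity*, Quantum Sci. Technol. 10 (2025) 015021 = arXiv:2307.03283 [BaspinEtAl2024] (held text
`paper:arxiv-2307.03283`), §2.1, §2 Lemma 2.3, §3.2 Lemma 3.5 and Theorem 1.1 (formal), read on the page:

> «Outer boundary: ∂₊U is the set of all qubits v ∈ Ū such that for some u ∈ U, the edge {u,v} ∈ E.»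
> (chunk p0005 L23–27)
> «Expansion Lemma: Given correctable regions U, T such that T ⊃ ∂₊U, then T ∪ U is correctable.» (Lemma 2.3,
> chunk p0005 L66–67; «We refer to [Bravyi–Terhal 2009, Flammia–Haah–Kastoryano–Kim 2017] for proofs»)
> «Lemma 3.5. Let β ≥ 1 and c ∈ (0,1) be constants. The following holds for all positive integers n ≥ d. Let G be
> a graph on n vertices with separation profile s_G(r) ≤ βr^c for all r. For ε' = (1 − (2/3)^c)/(20β), any set W of
> at most (εd)^{1/c} vertices with outer boundary at most d/4 is d-correctable.» (chunk p0008 L16–21; proof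
> L22–52: «Recursively construct a rooted binary tree … |∂₊U| ≤ |∂₊W| + Σ_{U' ancestor of U} |S(U')| ≤ d/4 +
> β|W|^c/(1−(2/3)^c) … We inductively show every set U labeling a node in the tree 𝒯 is correctable … (Union
> Lemma) … (Expansion Lemma) … (Trivial property)»)
> «Theorem (Theorem 1.1, formal). Let β ≥ 1 and c ∈ (0,1) be constants. There exists a constant α = α(β,c) > 0
> such that the following holds for all k ≥ 1 and positive integers n and d. Let 𝒬 be a [[n,k,d]] quantum code
> with connectivity graph G. If the separation profile of G satisfies s_G(r) ≤ βr^c for c ∈ (0,1], then d ≤ αn^c.»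
> (chunk p0008 L57–63; proof L65–68: Lemma 3.5 applied to W = V with ∂₊V = ∅ — «the set V of all vertices is
> correctable. Then k = 0, which contradicts the k > 0 assumption»); p0004 L25–27: «a degree-oblivious bound on
> the distance … That result [Baspin–Krishna 2022] only held for quantum LDPC codes».

What this file proves (KERNEL, no named fact), for stabilizer codes presented by a generator family
`g : G → 𝔽₂ⁿ × 𝔽₂ⁿ` (`S̄ = ⟨g⟩`), in the vocabulary of `CorrectableRegions.lean` and `ConnectivityDimensionBound.lean`
(`connGraph`, `Decoupled`, `IsHalfSeparable`):
* `CoversOuterBoundary g U B` — «`B ⊇ ∂₊U`» at generator level: every qubit outside `U` of a generator meeting `U`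
  lies in `B`; `coversOuterBoundary_iff_adj` says this is literally «every `v ∉ U` adjacent in the connectivity graph
  to some `u ∈ U` lies in `B`»;
* **`IsCorrectableRegion.union_of_coversOuterBoundary`** — the Expansion Lemma in the `∂₊` form used by the paper
  (`U`, `T` correctable, `T ⊇ ∂₊U` ⇒ `U ∪ T` correctable), proved from the Cleaning Lemma exactly as the tree's
  `IsCorrectableRegion.union_of_crossing` (Bravyi–Poulin–Terhal Cor. 1, whose hypothesis «crossing generators live in
  `F`» is the `∂ = ∂₋ ∪ ∂₊` variant);
* `BaspinEtAl2024_lemma35_inv` — the induction behind Lemma 3.5 with its potential made explicit: if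
  `|B| + K·|U|^c < d/2` for some `B ⊇ ∂₊U`, `K = C/(1 − 2^{−c})`, then `U` is correctable (the potential does not
  increase from a node to its children: the child's boundary grows by the separator `≤ C|U|^c` while `K|·|^c` drops
  by the factor `2^{−c}`);
* **`BaspinEtAl2024_lemma35`** — Lemma 3.5 in printed shape at `α = 1/2`: `|W| ≤ (εd)^{1/c}` with
  `ε = (1 − 2^{−c})/(20C)` and `|∂₊W| ≤ d/4` ⇒ `W` correctable;
* **`BaspinEtAl2024_theorem11`** — Theorem 1.1 (formal «thm:main-2») with an explicit constant: for every `[[n,k,d]]`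
  stabilizer code with `k ≥ 1` whose connectivity graph is `(s,1/2)`-separable with `s(m) ≤ C·m^c`, `c > 0`:
  `d ≤ 2C/(1 − 2^{−c}) · n^c`. No degree / LDPC hypothesis, as the paper stresses.

FAITHFULNESS / SCOPE. (a) Separators: the paper's `sep(G)` is `2/3`-balanced (Definition 2.8) and the profile is
`s_G(r) = max over subgraphs with ≤ r vertices`; this file, like `ConnectivityDimensionBound.lean`, works with the
`1/2`-balanced separations of ALL vertex subsets (`IsHalfSeparable g s`, Baspin–Krishna's normal form) and a bound
`s(m) ≤ C·m^c` — so the printed `(2/3)^c` becomes `2^{−c}` in the constants, which the paper leaves as «α(β,c)»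
anyway. -- TODO(general form): `2/3`-balanced profiles (convert to `1/2` by iterating separators, constant
`β/(1−(2/3)^c)`; [Lipton–Tarjan 1979]) are not typed. (b) `c ∈ (0,1]` in print; only `0 < c` is used. (c) NOT typed
here: Theorem «thm:main» `k·d^{(1−c²)/c} ≤ αn` (its Lemma 3.6 rests on the `r`-division Lemma 2.10 =
Henzinger–Klein–Rao–Subramanian 1997 Lemma 2.1, a separate graph-theoretic result the tree lacks), §3.1 (=
Baspin–Krishna's bound, already `BaspinKrishna2022_corollary23`), §4 conjectures.

HONEST FRAMING (LADDER-QEC X1): a BARRIER theorem generalizing Bravyi–Terhal (`D`-dimensional local codes have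
`c = 1 − 1/D`, `d = O(L^{D−1})`) to arbitrary stabilizer codes through the separation profile of the connectivity
graph; a 2023/2025 result formalized, no novelty.

## References
* [BaspinEtAl2024] N. Baspin, V. Guruswami, A. Krishna, R. Li, Quantum Sci. Technol. 10 (2025) 015021 =
  arXiv:2307.03283: §2.1 (∂₊, ∂₋; chunk p0005 L21–27), Lemma 2.3 (chunk p0005 L54–67), Lemma 3.5 (chunk p0008
  L16–52), Theorem 1.1 formal (chunk p0008 L57–68).
* [BaspinKrishna2022] N. Baspin, A. Krishna, Quantum 6 (2022) 711 — connectivity graph, separability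
  (`ConnectivityDimensionBound.lean`).
* [BravyiPoulinTerhal2010], [BravyiTerhal2009] — correctable regions, Cleaning Lemma, Expansion
  (`CorrectableRegions.lean`, `QuantumSingletonBound.lean`).

## Mathlib / tree search
`rg 'outer|boundary|xpansion' Literature/InformationTheory/QuantumCodes` (2026-08-27): the Expansion Lemma exists as
`IsCorrectableRegion.union_of_crossing` (full-boundary form); no `∂₊` form, no separation-profile distance bound.
Reused: `IsCorrectableRegion`, `.of_card_lt`, `.mono`, `.union`, `not_isCorrectableRegion_univ`,
`sup_sympDual_inf_supportedOn_compl_eq` (Cleaning Lemma), `proj`, `supportedOn`, `mem_sympDual_span_of_forall`,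
`connGraph`, `Decoupled`, `IsHalfSeparation`, `IsHalfSeparable`; Mathlib `Real.rpow`.
-/

namespace Literature.InformationTheory.QuantumCodes

open Finset

variable {n : ℕ} {G : Type*} (g : G → SympVec n)

/-! ### Outer boundary covers and the Expansion Lemma in `∂₊` form -/

/-- **`B` covers the outer boundary of `U`** (`B ⊇ ∂₊U`): whenever a generator meets `U`, each of its qubits outside
`U` lies in `B` («∂₊U is the set of all qubits v ∈ Ū such that for some u ∈ U, the edge {u,v} ∈ E»). (definition)
[cite: BaspinEtAl2024, §2.1 (outer boundary; arXiv:2307.03283 chunk p0005 L23–27)] -/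
def CoversOuterBoundary (U B : Finset (Fin n)) : Prop :=
  ∀ a, ∀ q ∈ sympSupport (g a), ∀ q' ∈ sympSupport (g a), q ∈ U → q' ∉ U → q' ∈ B

/-- `CoversOuterBoundary g U B` says exactly `∂₊U ⊆ B` for the connectivity graph: every vertex outside `U` adjacent
to a vertex of `U` lies in `B`. [cite: BaspinEtAl2024, §2.1 (outer boundary; chunk p0005 L23–27)] -/
theorem coversOuterBoundary_iff_adj {U B : Finset (Fin n)} :
    CoversOuterBoundary g U B ↔ ∀ u ∈ U, ∀ v, v ∉ U → (connGraph g).Adj u v → v ∈ B := by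
  constructor
  · rintro h u hu v hv ⟨-, a, hua, hva⟩
    exact h a u hua v hva hu hv
  · intro h a q hq q' hq' hqU hq'U
    refine h q hqU q' hq'U ⟨?_, a, hq, hq'⟩
    rintro rfl
    exact hq'U hqU

/-- Enlarging the cover. [cite: BaspinEtAl2024, §2.1 (outer boundary; chunk p0005 L23–27)] -/
theorem CoversOuterBoundary.mono {U B B' : Finset (Fin n)} (h : CoversOuterBoundary g U B) (hBB' : B ⊆ B') :
    CoversOuterBoundary g U B' :=
  fun a q hq q' hq' hqU hq'U => hBB' (h a q hq q' hq' hqU hq'U)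

/-- The whole vertex set has empty outer boundary («with the observation that ∂₊V = ∅»).
[cite: BaspinEtAl2024, §3.2 proof of Theorem 1.1 (chunk p0008 L65–66)] -/
theorem coversOuterBoundary_univ (B : Finset (Fin n)) : CoversOuterBoundary g univ B :=
  fun _ _ _ q' _ _ hq' => absurd (mem_univ q') hq'

/-- A generator meeting `U` is supported in `U ∪ B` when `B ⊇ ∂₊U`. [cite: BaspinEtAl2024, §2.1 (chunk p0005 L23–27)] -/
theorem CoversOuterBoundary.mem_supportedOn_union {U B : Finset (Fin n)} (h : CoversOuterBoundary g U B) {a : G}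
    (hmeet : ∃ q ∈ sympSupport (g a), q ∈ U) : g a ∈ supportedOn (U ∪ B) := by
  obtain ⟨q, hq, hqU⟩ := hmeet
  refine mem_supportedOn_of_forall_sympSupport fun q' hq' => ?_
  by_cases hq'U : q' ∈ U
  · exact mem_union_left _ hq'U
  · exact mem_union_right _ (h a q hq q' hq' hqU hq'U)

/-- **Expansion Lemma, `∂₊` form** («Given correctable regions U, T such that T ⊃ ∂₊U, then T ∪ U is correctable»),
for a self-orthogonal `S̄ = ⟨g⟩`. Proof (Cleaning Lemma, as for Bravyi–Poulin–Terhal Cor. 1): clean a logical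
operator `P` off `T`; a generator meeting `U` is supported in `U ∪ T`, where the cleaned `P'` has only its `U`-part,
so `ρ_U P'` is a logical operator inside `U`, hence a stabilizer; thus every logical class has a representative
supported outside `U ∪ T`, which commutes with every `Q ∈ S̄⊥ ∩ P(U ∪ T)`, so such `Q` lie in `S̄⊥⊥ = S̄`.
[cite: BaspinEtAl2024, §2 Lemma 2.3 (Expansion Lemma; chunk p0005 L66–67)] -/
theorem IsCorrectableRegion.union_of_coversOuterBoundary {S : Submodule (ZMod 2) (SympVec n)}
    (hS : S = Submodule.span (ZMod 2) (Set.range g)) (hself : IsSelfOrthogonal S) {U T : Finset (Fin n)}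
    (hU : IsCorrectableRegion S U) (hT : IsCorrectableRegion S T) (hB : CoversOuterBoundary g U T) :
    IsCorrectableRegion S (U ∪ T) := by
  have hclean := sup_sympDual_inf_supportedOn_compl_eq hself hT.inf_le
  intro Q hQd hQs
  rw [← sympDual_sympDual S, mem_sympDual_iff]
  intro P hP
  rw [← hclean] at hP
  obtain ⟨s₀, hs₀, P', ⟨hP'd, hP'T⟩, rfl⟩ := Submodule.mem_sup.1 hP
  -- the part of P' outside U lives outside U ∪ T
  have hout : proj Uᶜ P' ∈ supportedOn (U ∪ T)ᶜ := by
    rw [compl_union]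
    exact mem_supportedOn_inter (proj_mem_supportedOn Uᶜ P') (proj_mem_supportedOn_of_mem Uᶜ hP'T)
  -- the U-part of P' commutes with every generator
  have hUd : proj U P' ∈ sympDual S := by
    subst hS
    refine mem_sympDual_span_of_forall g fun a => ?_
    by_cases hmeet : ∃ q ∈ sympSupport (g a), q ∈ U
    · have hg : g a ∈ supportedOn (U ∪ T) := hB.mem_supportedOn_union g hmeet
      have h2 : sympInner (g a) P' = 0 := (mem_sympDual_iff.1 hP'd) (g a) (Submodule.subset_span ⟨a, rfl⟩)
      have h3 : sympInner (g a) (proj Uᶜ P') = 0 := sympInner_eq_zero_of_supportedOn_compl hg hout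
      rw [← proj_add_proj_compl U P', sympInner_comm, sympInner_add_left, sympInner_comm (proj Uᶜ P'), h3,
        add_zero, sympInner_comm] at h2
      exact h2
    · push Not at hmeet
      have hg : g a ∈ supportedOn Uᶜ := mem_supportedOn_compl_of_forall_sympSupport hmeet
      rw [sympInner_comm]
      exact sympInner_eq_zero_of_supportedOn_compl (proj_mem_supportedOn U P') hg
  have h1 : sympInner s₀ Q = 0 := (mem_sympDual_iff.1 hQd) s₀ hs₀
  have h2 : sympInner (proj U P') Q = 0 := (mem_sympDual_iff.1 hQd) _ (hU _ hUd (proj_mem_supportedOn U P'))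
  have h3 : sympInner (proj Uᶜ P') Q = 0 := by
    rw [sympInner_comm]
    exact sympInner_eq_zero_of_supportedOn_compl hQs hout
  rw [sympInner_add_left, h1, zero_add, ← proj_add_proj_compl U P', sympInner_add_left, h2, h3, add_zero]

/-! ### Lemma 3.5: sets with small outer boundary are correctable -/

/-- The children of a separation inherit a boundary cover: `∂₊A ⊆ ∂₊U ∪ S(U)` («∂₊W contains all neighbors of
vertices of U outside W, and ⋃_{U' ancestor of U} S(U') contains all neighbors of U inside W»).
[cite: BaspinEtAl2024, §3.2 Lemma 3.5, proof (chunk p0008 L29–31)] -/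
theorem CoversOuterBoundary.child {U B A A' : Finset (Fin n)} (hB : CoversOuterBoundary g U B)
    (hsepn : IsHalfSeparation g U A A') : CoversOuterBoundary g A (B ∪ U \ (A ∪ A')) := by
  obtain ⟨hAU, -, -, -, -, hdec⟩ := hsepn
  intro a q hq q' hq' hqA hq'A
  by_cases hq'U : q' ∈ U
  · refine mem_union_right _ (mem_sdiff.2 ⟨hq'U, ?_⟩)
    rw [mem_union, not_or]
    exact ⟨hq'A, hdec a q hq q' hq' hqA⟩
  · exact mem_union_left _ (hB a q hq q' hq' (hAU hqA) hq'U)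

section Real

open Real

/-- `0 < 2^{-c} < 1` for `c > 0`. [cite: BaspinEtAl2024, §3.2 Lemma 3.5, proof (the geometric factor; chunk p0008 L36–38)] -/
private theorem two_rpow_neg_bounds {c : ℝ} (hc : 0 < c) : 0 < (2 : ℝ) ^ (-c) ∧ (2 : ℝ) ^ (-c) < 1 :=
  ⟨rpow_pos_of_pos two_pos _, rpow_lt_one_of_one_lt_of_neg one_lt_two (neg_lt_zero.2 hc)⟩

/-- Halving the set costs the factor `2^{-c}`: `2a ≤ u ⇒ a^c ≤ 2^{-c}·u^c`.
[cite: BaspinEtAl2024, §3.2 Lemma 3.5, proof («each subsequent descendant's size is a factor … smaller»; chunk p0008 L39–40)] -/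
private theorem rpow_half_le {a u c : ℝ} (ha : 0 ≤ a) (hau : 2 * a ≤ u) (hc : 0 ≤ c) :
    a ^ c ≤ (2 : ℝ) ^ (-c) * u ^ c := by
  have hu : 0 ≤ u := by linarith
  calc a ^ c ≤ (u / 2) ^ c := rpow_le_rpow ha (by linarith) hc
    _ = u ^ c / (2 : ℝ) ^ c := div_rpow hu zero_le_two c
    _ = (2 : ℝ) ^ (-c) * u ^ c := by rw [rpow_neg zero_le_two, div_eq_mul_inv, mul_comm]

variable {S : Submodule (ZMod 2) (SympVec n)} {k d : ℕ} {s : ℕ → ℕ} {C c : ℝ}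

/-- **Lemma 3.5, invariant form (the induction over the separator tree).** Let `S̄ = ⟨g⟩` be an `[[n,k,d]]`
stabilizer code whose connectivity graph is `(s,1/2)`-separable with `s(m) ≤ C·m^c`, `c > 0`, and put
`K = C/(1 − 2^{−c})`. If `B ⊇ ∂₊U` and `|B| + K·|U|^c < d/2`, then `U` is correctable. Printed argument: separate
`U = A ⊔ S(U) ⊔ A'`; the children satisfy the same hypothesis with the cover `B ∪ S(U)` (their boundary grows by
`|S(U)| ≤ C|U|^c` while `K|A|^c ≤ 2^{−c}K|U|^c`, and `C + 2^{−c}K = K`), so they are correctable by induction; `A ∪ A'`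
is correctable (Union Lemma), `B ∪ S(U) ⊇ ∂₊(A ∪ A')` has fewer than `d` qubits (Distance), so
`(A ∪ A') ∪ (B ∪ S(U)) ⊇ U` is correctable (Expansion Lemma, Trivial).
[cite: BaspinEtAl2024, §3.2 Lemma 3.5, proof (chunk p0008 L22–52)] -/
theorem BaspinEtAl2024_lemma35_inv (hcode : IsAdditiveCode S k d) (hS : S = Submodule.span (ZMod 2) (Set.range g))
    (hsep : IsHalfSeparable g s) (hsC : ∀ m : ℕ, (s m : ℝ) ≤ C * (m : ℝ) ^ c) (hc : 0 < c)
    (U B : Finset (Fin n)) (hB : CoversOuterBoundary g U B)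
    (hlt : (#B : ℝ) + C / (1 - (2 : ℝ) ^ (-c)) * (#U : ℝ) ^ c < d / 2) : IsCorrectableRegion S U := by
  obtain ⟨ht0, ht1⟩ := two_rpow_neg_bounds hc
  set t : ℝ := (2 : ℝ) ^ (-c) with ht
  set K : ℝ := C / (1 - t) with hK
  have hC : 0 ≤ C := (Nat.cast_nonneg (s 1)).trans (by simpa using hsC 1)
  have h1t : (1 - t) ≠ 0 := (sub_pos.2 ht1).ne'
  have hK0 : 0 ≤ K := div_nonneg hC (by linarith)
  have hCK : C ≤ K := by
    rw [hK, le_div_iff₀ (by linarith)]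
    nlinarith
  have hKt : C + K * t = K := by
    have hK1 : K * (1 - t) = C := by rw [hK]; exact div_mul_cancel₀ C h1t
    linear_combination (-1 : ℝ) * hK1
  induction hm : #U using Nat.strong_induction_on generalizing U B with
  | _ m ih =>
    subst hm
    by_cases hUd : #U < d
    · exact IsCorrectableRegion.of_card_lt hcode.2.2.1 hUd
    have hU0 : 0 < #U := by
      by_contra h0
      have h0' : #U = 0 := by omega
      rw [h0', Nat.cast_zero, zero_rpow hc.ne', mul_zero, add_zero] at hlt
      have : (0 : ℝ) ≤ #B := Nat.cast_nonneg _
      have : (d : ℝ) ≤ 0 := by exact_mod_cast (show d ≤ 0 by omega)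
      linarith
    obtain ⟨A₁, A₂, hsepn, hcard⟩ := hsep U
    have hsepn' : IsHalfSeparation g U A₂ A₁ :=
      ⟨hsepn.2.1, hsepn.1, hsepn.2.2.1.symm, hsepn.2.2.2.2.1, hsepn.2.2.2.1, hsepn.2.2.2.2.2.symm⟩
    set Sep : Finset (Fin n) := U \ (A₁ ∪ A₂) with hSep
    have hSepC : (#Sep : ℝ) ≤ C * (#U : ℝ) ^ c := (Nat.cast_le.2 hcard).trans (hsC #U)
    have huc : 0 ≤ (#U : ℝ) ^ c := rpow_nonneg (Nat.cast_nonneg _) _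
    -- the cover of the children and its size
    have hT : (#(B ∪ Sep) : ℝ) ≤ #B + C * (#U : ℝ) ^ c :=
      (Nat.cast_le.2 (card_union_le B Sep)).trans (by push_cast; linarith)
    -- each child satisfies the hypothesis, hence is correctable
    have hchild : ∀ A A' : Finset (Fin n), IsHalfSeparation g U A A' → U \ (A ∪ A') = Sep →
        IsCorrectableRegion S A := by
      intro A A' hAA' hSepA
      have h2A : 2 * #A ≤ #U := hAA'.2.2.2.1
      have hA : (#A : ℝ) ^ c ≤ t * (#U : ℝ) ^ c :=
        rpow_half_le (Nat.cast_nonneg _) (by exact_mod_cast h2A) hc.le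
      refine ih #A (by omega) A (B ∪ Sep) (hSepA ▸ hB.child g hAA') ?_ rfl
      calc (#(B ∪ Sep) : ℝ) + K * (#A : ℝ) ^ c
          ≤ (#B + C * (#U : ℝ) ^ c) + K * (t * (#U : ℝ) ^ c) :=
            add_le_add hT (mul_le_mul_of_nonneg_left hA hK0)
        _ = #B + (C + K * t) * (#U : ℝ) ^ c := by ring
        _ = #B + K * (#U : ℝ) ^ c := by rw [hKt]
        _ < d / 2 := hlt
    have hA₁ : IsCorrectableRegion S A₁ := hchild A₁ A₂ hsepn rfl
    have hA₂ : IsCorrectableRegion S A₂ := hchild A₂ A₁ hsepn' (by rw [hSep, union_comm])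
    -- Union Lemma
    have hA : IsCorrectableRegion S (A₁ ∪ A₂) :=
      hA₁.union g hS hA₂ fun a ⟨q, hq, hqA⟩ q' hq' => hsepn.2.2.2.2.2 a q hq q' hq' hqA
    -- the cover B ∪ Sep of A₁ ∪ A₂ has fewer than d qubits
    have hTd : #(B ∪ Sep) < d := by
      have h : (#(B ∪ Sep) : ℝ) < d := by
        have := mul_le_mul_of_nonneg_right hCK huc
        have hd0 : (0 : ℝ) ≤ d := Nat.cast_nonneg _
        linarith
      exact_mod_cast h
    have hTcorr : IsCorrectableRegion S (B ∪ Sep) := IsCorrectableRegion.of_card_lt hcode.2.2.1 hTd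
    have hcov : CoversOuterBoundary g (A₁ ∪ A₂) (B ∪ Sep) := by
      intro a q hq q' hq' hqA hq'A
      have hqU : q ∈ U := by
        rcases mem_union.1 hqA with h | h
        · exact hsepn.1 h
        · exact hsepn.2.1 h
      by_cases hq'U : q' ∈ U
      · exact mem_union_right _ (mem_sdiff.2 ⟨hq'U, hq'A⟩)
      · exact mem_union_left _ (hB a q hq q' hq' hqU hq'U)
    -- Expansion Lemma and the Trivial property
    refine (hA.union_of_coversOuterBoundary g hS hcode.1 hTcorr hcov).mono fun x hx => ?_
    by_cases hxA : x ∈ A₁ ∪ A₂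
    · exact mem_union_left _ hxA
    · exact mem_union_right _ (mem_union_right _ (mem_sdiff.2 ⟨hx, hxA⟩))

/-- **Baspin–Guruswami–Krishna–Li, Lemma 3.5 (printed shape, `α = 1/2`).** With `ε = (1 − 2^{−c})/(20C)` (`C > 0`,
`c > 0`, `d ≥ 1`): every set `W` with `|W| ≤ (εd)^{1/c}` whose outer boundary is covered by a set `B` with `4|B| ≤ d`
is correctable («any set W of at most (εd)^{1/c} vertices with outer boundary at most d/4 is d-correctable», there
with `ε' = (1−(2/3)^c)/(20β)` for `2/3`-balanced separators). From the invariant form: `K·|W|^c ≤ Kεd = d/20` and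
`|B| ≤ d/4`, total `< d/2`. [cite: BaspinEtAl2024, §3.2 Lemma 3.5 (chunk p0008 L16–21)] -/
theorem BaspinEtAl2024_lemma35 (hcode : IsAdditiveCode S k d) (hS : S = Submodule.span (ZMod 2) (Set.range g))
    (hsep : IsHalfSeparable g s) (hsC : ∀ m : ℕ, (s m : ℝ) ≤ C * (m : ℝ) ^ c) (hC : 0 < C) (hc : 0 < c)
    (hd : 1 ≤ d) {W B : Finset (Fin n)} (hB : CoversOuterBoundary g W B) (hBd : 4 * #B ≤ d)
    (hW : (#W : ℝ) ≤ ((1 - (2 : ℝ) ^ (-c)) / (20 * C) * d) ^ (1 / c)) : IsCorrectableRegion S W := by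
  obtain ⟨ht0, ht1⟩ := two_rpow_neg_bounds hc
  set t : ℝ := (2 : ℝ) ^ (-c) with ht
  have hd0 : (0 : ℝ) < d := by exact_mod_cast hd
  have hε : 0 ≤ (1 - t) / (20 * C) * d := by positivity
  -- |W|^c ≤ ε d
  have hWc : (#W : ℝ) ^ c ≤ (1 - t) / (20 * C) * d := by
    have h := rpow_le_rpow (Nat.cast_nonneg _) hW hc.le
    rwa [← rpow_mul hε, one_div_mul_cancel hc.ne', rpow_one] at h
  refine BaspinEtAl2024_lemma35_inv g hcode hS hsep hsC hc W B hB ?_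
  have hB' : (#B : ℝ) ≤ d / 4 := by
    have : ((4 * #B : ℕ) : ℝ) ≤ d := by exact_mod_cast hBd
    push_cast at this
    linarith
  have h1t : (1 - t) ≠ 0 := (sub_pos.2 ht1).ne'
  have hCne : C ≠ 0 := hC.ne'
  have hK : C / (1 - t) * (#W : ℝ) ^ c ≤ d / 20 := by
    calc C / (1 - t) * (#W : ℝ) ^ c ≤ C / (1 - t) * ((1 - t) / (20 * C) * d) :=
          mul_le_mul_of_nonneg_left hWc (div_nonneg hC.le (by linarith))
      _ = d / 20 := by field_simp
  linarith

/-! ### Theorem 1.1: `d = O(n^c)` for every stabilizer code with a polynomial separation profile -/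

/-- **Baspin–Guruswami–Krishna–Li, Theorem 1.1 (formal version «thm:main-2»), explicit constant, `α = 1/2`.** For
every `[[n,k,d]]` stabilizer code with `k ≥ 1`, presented by generators whose connectivity graph is
`(s,1/2)`-separable with `s(m) ≤ C·m^c` for all `m` and some `c > 0`:
`d ≤ 2C/(1 − 2^{−c}) · n^c` («If the separation profile of G satisfies s_G(r) ≤ βr^c for c ∈ (0,1], then
d ≤ αn^c»). Proof as printed: otherwise Lemma 3.5 applies to `W = V` (`∂₊V = ∅`), so the whole lattice is
correctable and `k = 0`. No bound on the degree of the connectivity graph is assumed (the point of the theorem: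
Bravyi–Terhal made degree-oblivious). [cite: BaspinEtAl2024, §3.2 Theorem 1.1 formal (chunk p0008 L57–68); §1 (p0004 L25–38)] -/
theorem BaspinEtAl2024_theorem11 (hcode : IsAdditiveCode S k d) (hS : S = Submodule.span (ZMod 2) (Set.range g))
    (hk : 1 ≤ k) (hsep : IsHalfSeparable g s) (hsC : ∀ m : ℕ, (s m : ℝ) ≤ C * (m : ℝ) ^ c) (hc : 0 < c) :
    (d : ℝ) ≤ 2 * C / (1 - (2 : ℝ) ^ (-c)) * (n : ℝ) ^ c := by
  by_contra h
  rw [not_le] at h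
  refine not_isCorrectableRegion_univ hcode hk
    (BaspinEtAl2024_lemma35_inv g hcode hS hsep hsC hc univ ∅ (coversOuterBoundary_univ g ∅) ?_)
  rw [card_empty, Nat.cast_zero, zero_add, card_univ, Fintype.card_fin]
  have : C / (1 - (2 : ℝ) ^ (-c)) * (n : ℝ) ^ c = (2 * C / (1 - (2 : ℝ) ^ (-c)) * (n : ℝ) ^ c) / 2 := by ring
  rw [this]
  linarith

end Real

end Literature.InformationTheory.QuantumCodes
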